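import Summits.BirchSwinnertonDyer.BirchSwinnertonDyer.Theorems.SignedLowerHalvesSprungLowerDivisibilityAtThreeRankZeroBranch
import Summits.BirchSwinnertonDyer.Rank1Residual.SecondDescent.NonemptyRecordsThree08
import Summits.BirchSwinnertonDyer.Rank1Residual.SecondDescent.NonemptyRecordsThree05
import Summits.BirchSwinnertonDyer.Rank1Residual.SecondDescent.NonemptyRecordsThree07
import HarnessLib

/-!
# STUB-IDEAS k1, Plan C (per pair, common-zero TOLERANT): the r_an = 0 ∧ Surj(3) 'N' cells of the chromatic census
# already carry `BSD(E,3)` in the tree (b2b-bsdres second-descent records, 2026-08-22); composing with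
# `K1Branch.sprungSharpFlatLowerDivisibility_of_bsdp` (RankZeroBranch, 2026-08-27) gives K1's predicate — hence the
# K_spor content — for the pair WITHOUT any separation of the zeros of `L♯, L♭`. Sorry-free; records only; K1 / BSD /
# leaf X8 NOT proved by anything here; binders = the two source theorems' binders (published named facts + the cells'
# census data and descent witnesses, displayed).
-/

set_option autoImplicit false
set_option linter.dupNamespace false

noncomputable section

open scoped Classical NumberField MatrixGroups ModularForm
open NumberField IsDedekindDomain WeierstrassCurve CongruenceSubgroup
  Literature.NumberTheory.EllipticCurves Literature.NumberTheory.EllipticCurves.ModularForms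
  Literature.NumberTheory.EllipticCurves.Rank1Residual
  Literature.NumberTheory.EllipticCurves.Rank1Residual.Typed
  Literature.NumberTheory.EllipticCurves.Sprung2017 Literature.NumberTheory.EllipticCurves.Sprung2012
  Literature.NumberTheory.EllipticCurves.Sprung2024
  Literature.NumberTheory.EllipticCurves.ZpExtension
  Literature.NumberTheory.EllipticCurves.Wuthrich2014
  Summit.BirchSwinnertonDyer.Rank1Residual.Supersingular
  Summit.BirchSwinnertonDyer.Rank1Residual.SecondDescent
  Summit.BirchSwinnertonDyer.BirchSwinnertonDyer.Theses.SignedLowerHalves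
  Summit.BirchSwinnertonDyer.BirchSwinnertonDyer.Theorems

namespace Summit.BirchSwinnertonDyer.BirchSwinnertonDyer.Cruxes.SprungLowerDivisibilityAtThree
namespace KatoFineSporadicK1

/-- **C1 — `490100u1` ('N' cell, equal edge slopes {2}; `r_an = 0`, Surj(3), `#Ш_an = 81`, `∏c = 3`): K1's predicate
for EITHER colour from the tree's `BSD(E,3)` record `bsdp3_b1n_490100u1` (two NONEMPTY second-descent witnesses,
NO Cassels–Tate) through `K1Branch.sprungSharpFlatLowerDivisibility_of_bsdp`.** No zero of `L♯`/`L♭` is looked at.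
[cite: Sprung2012, Thm. 7.14, Thm. 7.16 and Main Conj. 7.21] [cite: Wuthrich2014, Lemma 20, Prop. 21] -/
theorem sprungSharpFlatLowerDivisibility_of_bsdpRecord_490100u1
    (h714 : thm714_sharpFlatSelmerDual_finite_torsion) (h716 : thm716_sharpFlatCharIdeal_divisibility)
    (h59 : lem59AllN_sharpFlatCharValue_rankZero) (h3 : realPeriodRat_eq_unit_mul_plusPeriod_three)
    (hL20 : Wuthrich2014.lemma20_surjective_threeAdic_of_semistable)
    (hGZK : rank_eq_analyticRank_of_analyticRank_le_one) (hmod : hasEntireLFunction_rat)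
    (hW : sha_dvd_analyticSha)
    (W : WeierstrassCurve ℚ) [W.IsElliptic] [W.IsGloballyMinimal]
    (hWm : W = ⟨0, 0, 0, -20410975, -35493084250⟩) (hX : ClassX8 W 3) (hs : Surj W 3)
    (hr : W.analyticRank = 0)
    {c₁ c₂ d₁ d₂ : W.sha} (h1 : 3 • c₁ = 0) (h2 : 3 • c₂ = 0) (hc₁ : c₁ ≠ 0)
    (hind : c₂ ∉ AddSubgroup.zmultiples c₁) (hd₁ : 3 • d₁ = c₁) (hd₂ : 3 • d₂ = c₂)
    {q : ℚ} (hq : shaAn W = (q : ℂ)) (hv : padicValRat 3 q ≤ 4) (col : Chroma) :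
    SprungSharpFlatLowerDivisibility W 3 col :=
  K1Branch.sprungSharpFlatLowerDivisibility_of_bsdp h714 h716 h59 h3 hL20 hGZK hmod W 3 hX hs hr
    (bsdp3_b1n_490100u1 hW hGZK hmod W hWm hr h1 h2 hc₁ hind hd₁ hd₂ hq hv) col

/-- **C2 — generic shape for `210469a1` / `425650k1` ('N', slopes {2} / {1, 1/2}; `#Ш_an = 81`): K1's predicate from ANY
landed `BSDp W 3` record on X8 ∧ Surj(3) ∧ `r_an = 0` (the ONE-WITNESS records `bsdp3_b1n1_210469a1`, `bsdp3_b1n1_425650k1`,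
Cassels–Tate displayed).** -/
theorem sprungSharpFlatLowerDivisibility_of_bsdpRecord
    (h714 : thm714_sharpFlatSelmerDual_finite_torsion) (h716 : thm716_sharpFlatCharIdeal_divisibility)
    (h59 : lem59AllN_sharpFlatCharValue_rankZero) (h3 : realPeriodRat_eq_unit_mul_plusPeriod_three)
    (hL20 : Wuthrich2014.lemma20_surjective_threeAdic_of_semistable)
    (hGZK : rank_eq_analyticRank_of_analyticRank_le_one) (hmod : hasEntireLFunction_rat)
    (W : WeierstrassCurve ℚ) [W.IsElliptic] [W.IsGloballyMinimal] (hX : ClassX8 W 3) (hs : Surj W 3)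
    (hr : W.analyticRank = 0) (col : Chroma)
    -- `hB` = `bsdp3_b1n1_210469a1 hCT hW hGZK hmod W hWm hr h1 h2 hc₁ hind hd hq hv` (NonemptyRecordsThree05 :98),
    -- resp. `bsdp3_b1n1_425650k1 …` (NonemptyRecordsThree07 :141): the generic record → K1 shape
    (hB : BSDp W 3) :
    SprungSharpFlatLowerDivisibility W 3 col :=
  K1Branch.sprungSharpFlatLowerDivisibility_of_bsdp h714 h716 h59 h3 hL20 hGZK hmod W 3 hX hs hr hB col

end KatoFineSporadicK1
end Summit.BirchSwinnertonDyer.BirchSwinnertonDyer.Cruxes.SprungLowerDivisibilityAtThree
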